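/-
Copyright (c) 2026 the pub-hodgecm-mathlib formalisation cell (harness21).  Prover seat hodgecm-mathlib-A-p03 (g24); LEAD F0P3a-plan (g9) WORD T8-41 «(F4)–(F8) PEN 1»,
architect A-p06 (g26) (MAP v3 §2 (F4)), 2026-09-01.
-/
import Literature.NumberTheory.Rogawski1990.UnitOrbitalIntegralInertCountJPosTorus
import HarnessLib

/-!
# Flicker's Prop. 10, the vanishing beyond `j = N`: no coset of `P_H ∩ H^K_m` conjugates `(r_i)⁻¹ t_θ r_i` into `H^K_m` when `2i + θ̄ > N`

Topic `NumberTheory/Rogawski1990` (road «D-N7-inert», MAP v3 (F4); the support bound Cor. 9's `∑ᶠ_i` needs); namespace `Literature.NumberTheory.Automorphic.UnitaryGroup`.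
THEOREMS ONLY: no definition, no named fact, no instance, no notation, no `sorry`; kernel lane.

Flicker sums Cor. 9 over `j ≤ N` only (p. 85: «since `ρ_θ` is regular … `ν = N − j`»; p. 86: «to have solutions we must have `ν ≥ 0`»): for `j > N` the corner entry `B₂ = −e(a−c)θ′ϖ^{−2i}`
of `τ_j = (r_i)⁻¹ t_θ r_i` has `|B₂| = |ϖ|^{N−j} > 1`, so the FIRST congruence `|uσu·B₂| ≤ 1` of ★ `borel_conj_mem_flickerHK_iff` fails for every `p ∈ P_H` and the coset count is `0`
(**`natCard_cosets_eq_zero_of_one_lt`**, corner form; **`natCard_cosets_flickerTorus_eq_zero_of_lt`**, torus literal with `N < 2i + θ̄`).  With ★ `natCard_cosets_flickerTorus_eq_iTen`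
(`1 ≤ j ≤ N`) and Prop. 13 (`j = 0`, p04∕F0P3b-p01) this bounds the support of B-p04's ★ `natCard_fixedPoints_centralizer_eq_finsum` to `i ≤ N∕2`.
HONEST LABEL: HC_CM is proved only modulo the printed citations until rung 0 closes.

## References
* [Flicker1998UnitaryFL] Y. Z. Flicker, *Elementary proof of the fundamental lemma for a unitary group*, Canad. J. Math. 50 (1998), 74–98: §4 p. 85, Prop. 10 p. 86.
* [Rogawski1990] J. D. Rogawski, *Automorphic Representations of Unitary Groups in Three Variables* (1990), §4.9 p. 55.
-/

set_option autoImplicit false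

open scoped MatrixGroups WithZero Valued
open Matrix

namespace Literature.NumberTheory.Automorphic

namespace UnitaryGroup

open Literature.NumberTheory.Automorphic.HermitianLattice (unitaryInt mem_unitaryInt_iff LocalConjDatum)

variable {K : Type*} [Field K] [Valued K ℤᵐ⁰] {ϖ : K} (σ : K →+* K) {J : Matrix (Fin 3) (Fin 3) K}

/-- **No solution when `|B₂| > 1`** (`j > N`): the coset count of `τ = !![A,0,B₁; 0,b,0; B₂,0,A]` vanishes, since the (3,1)-entry `uσu·B₂` of `p⁻¹τp` is never integral.
[cite: Flicker1998UnitaryFL, Prop. 10 p. 86; §4 p. 85] -/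
theorem natCard_cosets_eq_zero_of_one_lt (hJ : J = (StdForm.antidiagonal 3).over K) (hd : LocalConjDatum σ ϖ) {y : K} (hy : y * σ y = -2) (m : ℕ)
    {c um τ : ↥(unitaryGroupOfForm σ J)} (hc : ((c : GL (Fin 3) K) : Matrix (Fin 3) (Fin 3) K) = !![1, 0, 0; 0, -1, 0; 0, 0, 1])
    (hum : ((um : GL (Fin 3) K) : Matrix (Fin 3) (Fin 3) K) = !![ϖ ^ m, y, (ϖ ^ m)⁻¹; 0, 1, -σ y * (ϖ ^ m)⁻¹; 0, 0, (ϖ ^ m)⁻¹])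
    {A B₁ B₂ b : K} (hτ : ((τ : GL (Fin 3) K) : Matrix (Fin 3) (Fin 3) K) = !![A, 0, B₁; 0, b, 0; B₂, 0, A])
    (hτH : τ ∈ Subgroup.centralizer ({c} : Set ↥(unitaryGroupOfForm σ J))) (hgt : 1 < Valued.v B₂) :
    Nat.card {w : ↥(flickerPH σ J c) ⧸ (flickerHK σ J c um).subgroupOf (flickerPH σ J c) //
      ((Quotient.out w : ↥(flickerPH σ J c)) : ↥(unitaryGroupOfForm σ J))⁻¹ * τ * (Quotient.out w : ↥(flickerPH σ J c)) ∈ flickerHK σ J c um} = 0 := by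
  have h2 : (2 : K) ≠ 0 := fun h => by have := hd.v2; rw [h, map_zero] at this; exact zero_ne_one this
  refine natCard_cosets_eq_zero_of_forall_not σ fun p hp hmem => ?_
  obtain ⟨u, x, w, hpm, hvu, hvx, hσx, hvw, hσw⟩ := exists_coe_eq_borel_of_mem_flickerPH σ hJ hd hc hp
  have hu0 : u ≠ 0 := fun h => by rw [h, map_zero] at hvu; exact zero_ne_one hvu
  have hσu0 : σ u ≠ 0 := fun h => hu0 (by rw [← hd.σσ u, h, map_zero])
  have hw0 : w ≠ 0 := fun h => by rw [h, map_zero] at hvw; exact zero_ne_one hvw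
  have hpH : p ∈ Subgroup.centralizer ({c} : Set ↥(unitaryGroupOfForm σ J)) := ((mem_flickerPH_iff h2 hc).1 hp).1.1
  obtain ⟨h₁, -, -, -⟩ := (borel_conj_mem_flickerHK_iff σ hJ hd hy m hu0 hσu0 hw0 hum hpm hτ hpH hτH).1 hmem
  rw [map_mul, map_mul, hd.vσ, hvu, one_mul, one_mul] at h₁
  exact absurd hgt (not_lt.2 h₁)

/-- **The same at the torus literal**: for `t_θ` (F0P3-p02's literal), `r_i = diag(ϖ⁻¹^i, 1, ϖ^i)` and `N < 2i + θ̄` (`|a − c| = |ϖ^N|`), the coset count of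
`(r_i)⁻¹ t_θ r_i` is `0` — the summands of Cor. 9 beyond `j = N` vanish. [cite: Flicker1998UnitaryFL, §4 p. 85; Prop. 10 p. 86] -/
theorem natCard_cosets_flickerTorus_eq_zero_of_lt (hJ : J = (StdForm.antidiagonal 3).over K) (hd : LocalConjDatum σ ϖ) {y : K} (hy : y * σ y = -2)
    {c um t r : ↥(unitaryGroupOfForm σ J)} (hc : ((c : GL (Fin 3) K) : Matrix (Fin 3) (Fin 3) K) = !![1, 0, 0; 0, -1, 0; 0, 0, 1])
    {m : ℕ} (hum : ((um : GL (Fin 3) K) : Matrix (Fin 3) (Fin 3) K) = !![ϖ ^ m, y, (ϖ ^ m)⁻¹; 0, 1, -σ y * (ϖ ^ m)⁻¹; 0, 0, (ϖ ^ m)⁻¹])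
    {e θ θ' a b cc : K} (h2e : 2 * e = 1) {θbar : ℕ} (hθ' : θ' = (ϖ ^ θbar)⁻¹)
    (hte : ((t : GL (Fin 3) K) : Matrix (Fin 3) (Fin 3) K) = !![e * (a + cc), 0, -(e * (a - cc) * θ); 0, b, 0; -(e * (a - cc) * θ'), 0, e * (a + cc)])
    (htH : t ∈ Subgroup.centralizer ({c} : Set ↥(unitaryGroupOfForm σ J)))
    {i : ℕ} (hr : ((r : GL (Fin 3) K) : Matrix (Fin 3) (Fin 3) K) = !![ϖ⁻¹ ^ i, 0, 0; 0, 1, 0; 0, 0, ϖ ^ i])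
    (hrH : r ∈ Subgroup.centralizer ({c} : Set ↥(unitaryGroupOfForm σ J)))
    {N : ℕ} (hN : Valued.v (a - cc) = Valued.v (ϖ ^ N)) (hlt : N < 2 * i + θbar) :
    Nat.card {w : ↥(flickerPH σ J c) ⧸ (flickerHK σ J c um).subgroupOf (flickerPH σ J c) //
      ((Quotient.out w : ↥(flickerPH σ J c)) : ↥(unitaryGroupOfForm σ J))⁻¹ * (r⁻¹ * t * r) * (Quotient.out w : ↥(flickerPH σ J c)) ∈
        flickerHK σ J c um} = 0 := by
  have h2v : Valued.v (2 : K) = 1 := hd.v2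
  have hϖ0 : ϖ ≠ 0 := hd.ϖ_ne_zero
  have hve : Valued.v e = 1 := by
    have := congrArg Valued.v h2e; rw [map_mul, h2v, one_mul, map_one] at this; exact this
  have hτ := coe_radial_inv_mul_flickerTorus_mul_radial σ hϖ0 i hte hr
  have hτH : r⁻¹ * t * r ∈ Subgroup.centralizer ({c} : Set ↥(unitaryGroupOfForm σ J)) :=
    Subgroup.mul_mem _ (Subgroup.mul_mem _ (Subgroup.inv_mem _ hrH) htH) hrH
  refine natCard_cosets_eq_zero_of_one_lt σ hJ hd hy m hc hum hτ hτH ?_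
  -- `|B₂| = |ϖ|^{N − 2i − θ̄} > 1`
  have e1 : Valued.v (-(e * (a - cc) * θ') * (ϖ⁻¹ ^ i * ϖ⁻¹ ^ i)) =
      Valued.v (a - cc) * Valued.v θ' * (Valued.v ((ϖ ^ i)⁻¹) * Valued.v ((ϖ ^ i)⁻¹)) := by
    rw [inv_pow]; simp only [Valuation.map_neg, map_mul, hve, one_mul]
  rw [e1, hN, hθ', hd.v_pow_inv, hd.v_pow_inv, hd.v_pow, ← WithZero.exp_add, ← WithZero.exp_add, ← WithZero.exp_add,
    ← WithZero.exp_zero, WithZero.exp_lt_exp]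
  omega

end UnitaryGroup

end Literature.NumberTheory.Automorphic
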